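import Summits.QuantumFields.YangMills.Theorems.UnitScaleTiltProp7OneFormAgmonWeights
import Summits.QuantumFields.YangMills.Theorems.UnitScaleTiltProp7CombGaugeIter
import Summits.QuantumFields.YangMills.Theorems.UnitScaleTiltProp7TwistedSliceGaugeOntoTower
import HarnessLib

/-!
# Route `UnitScaleTilt`, crux K1 «MinimiserStabilityRegPr» (stmt-QuantumFields-19200), EX face S46 — (L3′b), ONE-FORM STOREY, pen (P-1FA), FILE A2g:
# ★★★ **THE `hVconj` BINDER OF A4b ✓∕⧗`Prop7OneFormBlockDecayAll.blockDecay_allBlocks_of_letters`, UNIFORMLY OVER THE CLASS OF FINE-LIPSCHITZ PHASES** — for every `φ` with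
# `|φ x − φ x′| ≤ r·η·tdist x x′`, A4's `hVconj` text at `w = e^{φ}` and the slot of record `Δx := DeltaEtaSlot`, with ONE θ_V depending on `r` and the member letters only
# (★p1 g26 08:33:36Z «does A2c deliver θ_V UNIFORMLY over this class?» — YES, after re-lettering the class from per-bond to fine-`ℓ¹` Lipschitz; width seat `ym3-torus-px21` gen 14)

Cell `ym3-torus` (HUMAN RULING D-0037; rung R3 = SU(2) YM₃ on T³ — NOT d = 4, NOT infinite volume, NOT a mass gap, NOT Clay).
THEOREMS ONLY (0 `def`, 0 `sorry`, default heartbeats); `--supports stmt-QuantumFields-19200 --as helper`; count-neutral.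

HOW.  ✓p766250 `Prop7OneFormAgmonWeights.hVconj_exp_of_letters` at `μ := r`, `θ := r·η` (per-bond from fine-Lipschitz by ✓`tdist_src_tgt_le_one`), `β := min 1 ((μ′ − r)∕2)` (so `0 < β ≤ 1`,
`r + β < μ′`), reference sites := the CORNERS of the source blocks (✓`Prop7CombGauge.iterBlockOf_fibreSite`, so NO `hxr`), the slot letter killed by ✓`hslot_DeltaEtaSlot`; the only
`η`-dependence left, `e^{2rη}` in the local term, is majorised by `e^{2r}` (`η ≤ 1`).
WHAT IS PROVED (ns `Summit.QuantumFields.YangMills.Theorems.Prop7OneFormAgmonPhaseClass`).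
* `beta_rows` (the three rows of `β := min 1 ((μ′−r)∕2)`), `iterBlockOf_src_corner` (the corner of `ĉ₋` lies in `ĉ₋`; ✓`eta_le_one` cited from `Prop7TwistedSliceGaugeOntoTower`).
* ★★★ `hVconj_phaseClass_of_letters` — `RegPr F n K ε₀ U₀` + routeR-w4's windows, `0 ≤ a`, `0 ≤ r < μ′`, the two member letters `hk` (the EX row `h349`'s kernel text, `Ck`, `μ′`) and
  `hQ` (`‖Q_k v‖ ≤ C_Q‖v‖`, px17 ✓p764941): FOR EVERY `φ` with `|φ x − φ x′| ≤ r·η·tdist x x′` and EVERY `X`, A4∕A4b's `hVconj` text at `Δx := DeltaEtaSlot` with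
  `θ_V := a·(2√κ²C_Q + κ²) + √2·Ck·(r·d·e^{rd}∕β)·(d(L^d)^{K−n}(2(1+1∕(μ′−(r+β))))³) + 0 + 32√2·ε₀·d·6^d·(1 + e^{2r})`, `κ² = 216(e^{r(d+1)}−1)²(cB∕(c₀ℓ³))`, `β = min 1 ((μ′−r)∕2)`.
HYP-SAT (★★OWNER RULING №42): `hk` ⟸ V6 + (ii-c) ∕ px10 ✓`kernelRow349_allMembers_exists` under Lift; `hQ` ⟸ ✓`norm_Qk_le_of_regPr`; the class row is satisfied by A4b's own `φ_v = rη·max 0 (tdist · x_v − 3ℓ)`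
(`|max 0 a − max 0 b| ≤ |a − b|` + ✓`tdist_triangle`); `r < μ′` = the Agmon rate below the h349 kernel rate; nothing eventual; no restatement.
HONEST SCOPE.  Instantiation; nothing of A4b's knit, the ten EX rows, `hT`, EX or the crux is proved here; the Yang–Mills mass gap is NOT proved.

References: T. Bałaban, CMP **99** (1985) 389–434 [Balaban1985BackgroundPropagators] (Thm 3.1 (3.46) p.398, (3.49) p.399); S. Agmon, *Lectures on exponential decay* (Princeton 1982) Ch. 1 [Agmon1982].
-/

set_option autoImplicit false

noncomputable section

open scoped BigOperators Matrix.Norms.L2Operator InnerProductSpace ComplexConjugate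

namespace Summit.QuantumFields.YangMills.Theorems.Prop7OneFormAgmonPhaseClass

open Literature.MathematicalPhysics.QuantumFieldTheory.Balaban1983to89
open Literature.MathematicalPhysics.QuantumFieldTheory.Balaban1983to89.T3ContinuumYM3Torus
open T3SectALandauChart (eta eta_pos bgUnits formComp)
open T3PrintedRegularMinimiser (RegPr)
open T3PrintedRegularOrbits (sites_eq)
open T3LevelShift (bondShift)
open B9TorusCalculus (torusT)
open B9Eq310Hermitian (deltaPrimeOp)
open B11Eq135Weitzenbock (curvOp)
open B11Eq103H1Complex (SiteL2K BondL2K)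
open B5Eq118OneStroke (iterBlockOf)
open B3Taylor310LocalRemainder (tdist_comm)
open Summit.QuantumFields.YangMills.Theorems.Prop7SectET3Transport (periodsT3)
open Summit.QuantumFields.YangMills.Theorems.Prop7SectET3HilbertLetters (W₂ toL2 toL2S DL2 DstarL2)
open Summit.QuantumFields.YangMills.Theorems.Prop7SectET3WilsonHessian (DeltaEta DeltaEtaSlot)
open Summit.QuantumFields.YangMills.Theorems.Prop7SectET3GaugeProjector (RS)
open Summit.QuantumFields.YangMills.Theorems.Prop7SectET3CurvedPropagators (laplaceA Qk)
open Summit.QuantumFields.YangMills.Theorems.Prop7BlockDistanceWeights (sitesPerDir_zero_eq_mul_pow tdist_src_tgt_le_one)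
open Summit.QuantumFields.YangMills.Theorems.Prop7OneFormAgmonConj (hslot_DeltaEtaSlot)
open Summit.QuantumFields.YangMills.Theorems.Prop7OneFormAgmonWeights (hVconj_exp_of_letters)
open Summit.QuantumFields.YangMills.Theorems.Prop7CombGauge (iterBlockOf_fibreSite)
open Summit.QuantumFields.YangMills.Theorems.Prop7TwistedSliceGaugeOntoTower (eta_le_one)

variable (F : T3Family) {n K : ℕ} (h : n ≤ K) (c₀ cB : ℝ) [Fact (0 < c₀)] [Fact (0 < cB)] {a : ℝ}

omit [Fact (0 < c₀)] [Fact (0 < cB)] in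
/-- The three rows of `β := min 1 ((μ′ − r)∕2)` for `r < μ′`: `0 < β`, `β ≤ 1`, `r + β < μ′`. [folklore] -/
theorem beta_rows {r μ' : ℝ} (hrμ : r < μ') : 0 < min 1 ((μ' - r) / 2) ∧ min 1 ((μ' - r) / 2) ≤ 1 ∧ r + min 1 ((μ' - r) / 2) < μ' := by
  refine ⟨lt_min one_pos (by linarith), min_le_left _ _, ?_⟩
  have := min_le_right (1 : ℝ) ((μ' - r) / 2)
  linarith

omit [Fact (0 < c₀)] [Fact (0 < cB)] in
/-- The corner of the source block of `ĉ` lies in that block (✓`Prop7CombGauge.iterBlockOf_fibreSite`). [cite: Balaban1985Averaging, (2) p.17] -/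
theorem iterBlockOf_src_corner (c : PBond (F.P n) 0) :
    iterBlockOf (K - n) (Site.fibreSite 0 (K - n) (bondShift (sites_eq F n K h) c).src fun _ => (⟨0, pow_pos (F.P K).L_pos (K - n)⟩ : Fin ((F.P K).L ^ (K - n))))
      = (bondShift (sites_eq F n K h) c).src := by
  have hk : K - n ≤ (F.P K).m + (F.P K).K := by show K - n ≤ F.m + K; have := F.hm; omega
  have hsp : (F.P K).sitesPerDir 0 = (F.P K).L ^ (K - n) * (F.P K).sitesPerDir (K - n) := by rw [sitesPerDir_zero_eq_mul_pow (K - n) hk, mul_comm]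
  exact iterBlockOf_fibreSite hk hsp _ _

/-- ★★★ **A4b's `hVconj` BINDER, UNIFORMLY OVER FINE-LIPSCHITZ PHASES, FROM THE MEMBER LETTERS.**  `RegPr F n K ε₀ U₀` + routeR-w4's windows; `0 ≤ a`; `0 ≤ r < μ′`; `hk` = the EX row `h349`'s
kernel text with a free `Ck` at rate `μ′`; `hQ : ‖Q_k v‖ ≤ C_Q‖v‖`.  THEN for every phase `φ` with `|φ x − φ x′| ≤ r·η·tdist x x′` and every bond field `X`, at the slot of record `Δx := DeltaEtaSlot`:
`re⟪toL2 X, Δ_a(toL2 X)⟫ − Σ_μ‖D(toL2S X_μ)‖² − θ_V‖toL2 X‖² ≤ re⟪toL2(e^{φ∘src}·X), Δ_a(toL2(e^{−φ∘src}·X))⟫ − re Σ_μ⟪D(toL2S (e^{φ∘src}·X)_μ), D(toL2S (e^{−φ∘src}·X)_μ)⟫` with the SINGLE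
`θ_V(r) = a·(2√κ²·C_Q + κ²) + √2·Ck·(r·d·e^{rd}∕β)·(d·(L^d)^{K−n}·(2(1+1∕(μ′−(r+β))))³) + 32√2·ε₀·d·6^d·(1 + e^{2r})`, `κ² = 216(e^{r(d+1)}−1)²(cB∕(c₀ℓ³))`, `β = min 1 ((μ′−r)∕2)` — independent of `φ`.
[cite: Balaban1985BackgroundPropagators, Thm 3.1 (3.46) p.398, (3.49) p.399, Thm 3.12 p.422; Balaban1985Variational, (134)–(136) p.298; Agmon1982, Ch. 1] -/
theorem hVconj_phaseClass_of_letters {ε₀ : ℝ} (hε₀ : 0 < ε₀) (hε : 10 ^ 10 * (F.L : ℝ) ^ 6 * ε₀ ≤ 1) (hε12 : 10 ^ 12 * (F.L : ℝ) ^ 3 * ε₀ ≤ 1)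
    (U₀ : GaugeField (F.P K) 0 (Matrix.specialUnitaryGroup (Fin 2) ℂ)) (hreg : RegPr F n K ε₀ U₀) (ha : 0 ≤ a)
    {r μ' Ck : ℝ} (hr : 0 ≤ r) (hrμ : r < μ') (hCk : 0 ≤ Ck)
    (hk : ∀ (b : PBond (F.P K) 0) (Z : Matrix (Fin 2) (Fin 2) ℂ) (bd : PBond (F.P K) 0),
      ‖(toL2 F K c₀).symm (DL2 F n K c₀ U₀ (DstarL2 F n K c₀ U₀ (toL2 F K c₀ (Pi.single b Z)) - RS F n K h c₀ cB U₀ (DstarL2 F n K c₀ U₀ (toL2 F K c₀ (Pi.single b Z))))) bd‖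
        ≤ Ck * Real.exp (-(μ' * (Site.tdist (P := F.P K) (iterBlockOf (K - n) b.src) (iterBlockOf (K - n) bd.src) : ℝ))) * ‖Z‖)
    {CQ : ℝ} (hQ : ∀ v : BondL2K ℂ 3 (periodsT3 F K) c₀ W₂, ‖Qk F n K h c₀ cB U₀ v‖ ≤ CQ * ‖v‖) :
    ∀ φ : Site (F.P K) 0 → ℝ, (∀ x x' : Site (F.P K) 0, |φ x - φ x'| ≤ r * eta F n K * (Site.tdist x x' : ℝ)) →
    ∀ X : PBond (F.P K) 0 → Matrix (Fin 2) (Fin 2) ℂ,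
      RCLike.re ⟪toL2 F K c₀ X, laplaceA F n K h c₀ cB a (DeltaEtaSlot F n K c₀) U₀ (toL2 F K c₀ X)⟫_ℂ
          - (∑ μ : Fin (F.P K).d, ‖DL2 F n K c₀ U₀ (toL2S F K c₀ (formComp X μ))‖ ^ 2)
          - (a * (2 * Real.sqrt (216 * (Real.exp (r * ((F.P K).d + 1)) - 1) ^ 2 * (cB / (c₀ * ((F.L : ℝ) ^ (K - n)) ^ 3))) * CQ
                  + 216 * (Real.exp (r * ((F.P K).d + 1)) - 1) ^ 2 * (cB / (c₀ * ((F.L : ℝ) ^ (K - n)) ^ 3)))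
              + Real.sqrt 2 * Ck * (r * (F.P K).d * Real.exp (r * (F.P K).d) / min 1 ((μ' - r) / 2))
                  * (((F.P K).d : ℝ) * ((((F.P K).L : ℝ) ^ (F.P K).d) ^ (K - n)) * (2 * (1 + 1 / (μ' - (r + min 1 ((μ' - r) / 2))))) ^ 3)
              + 32 * Real.sqrt 2 * ε₀ * (((F.P K).d : ℝ) * (2 * 3) ^ (F.P K).d) * (1 + Real.exp (2 * r))) * ‖toL2 F K c₀ X‖ ^ 2
        ≤ RCLike.re ⟪toL2 F K c₀ (fun b => Real.exp (φ b.src) • X b), laplaceA F n K h c₀ cB a (DeltaEtaSlot F n K c₀) U₀ (toL2 F K c₀ (fun b => (Real.exp (φ b.src))⁻¹ • X b))⟫_ℂ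
          - RCLike.re (∑ μ : Fin (F.P K).d, ⟪DL2 F n K c₀ U₀ (toL2S F K c₀ (formComp (fun b => Real.exp (φ b.src) • X b) μ)),
              DL2 F n K c₀ U₀ (toL2S F K c₀ (formComp (fun b => (Real.exp (φ b.src))⁻¹ • X b) μ))⟫_ℂ) := by
  intro φ hφ' X
  have hη : 0 < eta F n K := eta_pos F n K
  have hη1 : eta F n K ≤ 1 := eta_le_one F (n := n) (K := K)
  obtain ⟨hβ, hβ1, hνμ⟩ := beta_rows (r := r) (μ' := μ') hrμ
  -- per-bond slope from the fine-Lipschitz row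
  have hφ : ∀ b : PBond (F.P K) 0, |φ b.tgt - φ b.src| ≤ r * eta F n K := fun b => by
    have h1 := hφ' b.tgt b.src
    have h2 : (Site.tdist b.tgt b.src : ℝ) ≤ 1 := by
      rw [tdist_comm]; exact_mod_cast tdist_src_tgt_le_one b
    calc |φ b.tgt - φ b.src| ≤ r * eta F n K * (Site.tdist b.tgt b.src : ℝ) := h1
      _ ≤ r * eta F n K * 1 := mul_le_mul_of_nonneg_left h2 (mul_nonneg hr hη.le)
      _ = r * eta F n K := mul_one _
  -- the export at the corners of the source blocks and the slot of record
  have hmain := hVconj_exp_of_letters F h c₀ cB (a := a) (Δx := DeltaEtaSlot F n K c₀) hε₀ hε hε12 U₀ hreg ha φ hr hφ hφ'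
    (fun c => Site.fibreSite 0 (K - n) (bondShift (sites_eq F n K h) c).src fun _ => (⟨0, pow_pos (F.P K).L_pos (K - n)⟩ : Fin ((F.P K).L ^ (K - n))))
    (fun c => iterBlockOf_src_corner F h c) hβ hβ1 hνμ hCk hk hQ (hslot_DeltaEtaSlot F c₀ U₀ (fun x => Real.exp (φ x))) X
  -- majorise the `η`-dependent local constant: `(1 + (e^{rη} − 1))² = e^{2rη} ≤ e^{2r}`
  have hloc : (1 + (1 + (Real.exp (r * eta F n K) - 1)) ^ 2) ≤ 1 + Real.exp (2 * r) := by
    have e1 : (1 + (Real.exp (r * eta F n K) - 1)) ^ 2 = Real.exp (2 * (r * eta F n K)) := by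
      rw [add_sub_cancel, ← Real.exp_nat_mul]; norm_num
    rw [e1]
    have : 2 * (r * eta F n K) ≤ 2 * r := by nlinarith
    linarith [Real.exp_le_exp.mpr this]
  have hX0 : 0 ≤ ‖toL2 F K c₀ X‖ ^ 2 := sq_nonneg _
  have hC0 : 0 ≤ 32 * Real.sqrt 2 * ε₀ * (((F.P K).d : ℝ) * (2 * 3) ^ (F.P K).d) := by positivity
  have hmono := mul_le_mul_of_nonneg_left hloc hC0
  refine le_trans (sub_le_sub_left (mul_le_mul_of_nonneg_right ?_ hX0) _) hmain
  rw [add_zero]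
  exact add_le_add le_rfl hmono

end Summit.QuantumFields.YangMills.Theorems.Prop7OneFormAgmonPhaseClass

end
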